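import Summits.Ventures.LatticeQCDFlow.TrivializingMaps.AnnealingSufficiencyAnyGroup
import Summits.Ventures.LatticeQCDFlow.Scaling.WilsonSpecificHeatFloorCasimir
import Summits.Ventures.LatticeQCDFlow.Scaling.SpecificHeatFloorLog2Law

/-!
HONEST FRAMING: exact (Metropolis-corrected) sampling algorithms for lattice gauge theory; figures
of merit are autocorrelation/cost numbers at stated couplings and volumes; no continuum-physics
claim.

# SpecificHeatIntegralCeiling — THE SPECIFIC HEAT OF THE WILSON ACTION, INTEGRATED OVER THE COUPLING,
# IS AT MOST `2N·#plaq`: NO `c·#plaq/u` FLOOR, `c ≤ 2Nβ₀` FOR EVERY `c·#plaq/u²` FLOOR ON `[β₀, ∞)`,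
# AND THE THERMODYNAMIC LENGTH OF A COUPLING WINDOW IS AT MOST `√((b−a)·2N·#plaq)`
# (lean-2 GEN-10, ours)

Venture-side (OURS).  Cell `lqcd-flow` (pub-lqcd), unit `pub-lqcd-lean-2-g10`, 2026-08-23.  Sequel of
`AnnealingSufficiencyAnyGroup` (the fluctuation relation `⟨S_W⟩_a − ⟨S_W⟩_b = ∫_a^b Var_t(S_W) dt` and
`0 ≤ ⟨S_W⟩_t ≤ 2N·#plaq`, every compact gauge group).  An unconditional CEILING on the variance of the
Wilson action is not available pointwise in the coupling (and is false in general at a first-order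
transition in the infinite-volume limit); but INTEGRATED over the coupling it is elementary:

* §1 **`integral_variance_le`**: `∫_a^b Var_t(S_W^ρ) dt ≤ 2N·#plaq` for all real `a, b`, every compact
  `G`, every continuous `ρ`, every `d`, `L` — the specific heat per plaquette has coupling-integral
  `≤ 2N`, uniformly in the volume.
* §2 **`integral_sqrt_variance_sq_le`** (THERMODYNAMIC LENGTH): `(∫_a^b √Var_t dt)² ≤ (b−a)·(⟨S⟩_a − ⟨S⟩_b)
  ≤ (b−a)·2N·#plaq` (`a ≤ b`) — so the Fisher-information / thermodynamic-length NECESSITY bound for a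
  `k`-step annealing schedule across `[a, b]` (`cost ≥ length²/k`, `AnnealingThermodynamicLength`) never
  exceeds `2N·#plaq·(b−a)/k`, which is exactly the SUFFICIENCY bound of the uniform schedule
  (`uniform_schedule_cost_le_volume`): the two laws meet.
* §3 **`not_variance_ge_div`**: for `β₀ > 0`, `c > 0` there is NO floor `c/u ≤ Var_u(S_W)` on `[β₀, ∞)` —
  not even in one fixed volume (`∫ c/u = ∞`); **`floor_const_le_of_sq`**: a floor `c/u² ≤ Var_u(S_W)` on
  `[β₀, ∞)` forces `c ≤ 2N·#plaq·β₀`.  DOCKED to item 125's typed hypothesis (SH_W) (§4,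
  `wilsonSpecificHeatFloor_const_le`): `WilsonSpecificHeatFloor d L n β₀ c → c ≤ 2n·β₀` (`d ≥ 2`): the
  constant of theory2's theorem (SH_W) (item 128, `c = c(d,n,β₀) > 0`) is NECESSARILY `O(β₀)` as
  `β₀ → 0`, whatever the weak-coupling (Gaussian) count `(n²−1)/d` suggests for large `u`; the exponent
  `2` of (SH_W) cannot be lowered to `1`.

NOT CLAIMED: any pointwise ceiling on `Var_t(S_W)`; optimal schedules; finite-sample ESS; anything about
flows, autocorrelations or the continuum.  Literature grade (cell rule): elementary (fluctuation relation
+ `0 ≤ S_W ≤ 2N·#plaq`); new typing.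
-/

noncomputable section

open MeasureTheory ProbabilityTheory Set intervalIntegral
open Literature.MathematicalPhysics.QuantumFieldTheory
open Literature.MathematicalPhysics.QuantumFieldTheory.Luscher2010
open scoped Matrix Matrix.Norms.Frobenius ContDiff

namespace Summit.Ventures.LatticeQCDFlow.TrivializingMaps

section AnyGroup

variable {d L N : ℕ} [NeZero L] {G : Type*} [Group G] [TopologicalSpace G] [IsTopologicalGroup G]
  [CompactSpace G] [MeasurableSpace G] [BorelSpace G] [SecondCountableTopology G]
  (ρ : G →* Matrix (Fin N) (Fin N) ℂ)

/-! ## §1 The coupling-integrated specific heat is at most `2N·#plaq` -/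

/-- **`∫_a^b Var_t(S_W^ρ) dt ≤ 2N·#plaq`** for all real `a`, `b` (every compact gauge group, every
continuous representation, every volume). [ours] -/
theorem integral_variance_le (hρ : Continuous ρ) (a b : ℝ) :
    ∫ t in a..b, variance (wilsonAction (d := d) (L := L) ρ) (wilsonMeasure (d := d) (L := L) ρ t) ≤
      2 * N * Fintype.card (Plaquette d L) := by
  rw [← mean_sub_mean_eq_integral_variance (d := d) (L := L) ρ hρ a b]
  have hA := mean_wilsonAction_le (d := d) (L := L) ρ hρ a
  have hB := mean_wilsonAction_nonneg (d := d) (L := L) ρ hρ b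
  linarith

/-- `t ↦ Var_t(S_W^ρ)` is non-negative and continuous, hence interval integrable (bookkeeping). [folklore] -/
theorem intervalIntegrable_variance (hρ : Continuous ρ) (a b : ℝ) :
    IntervalIntegrable (fun t => variance (wilsonAction (d := d) (L := L) ρ)
      (wilsonMeasure (d := d) (L := L) ρ t)) volume a b :=
  (continuous_variance_wilsonMeasure hρ).intervalIntegrable a b

/-! ## §2 The thermodynamic length of a coupling window -/

/-- **THERMODYNAMIC LENGTH: `(∫_a^b √Var_t dt)² ≤ (b − a)·(⟨S_W⟩_a − ⟨S_W⟩_b)`** (`a ≤ b`; Cauchy–Schwarz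
through `2λ√V ≤ λ² + V` and the discriminant). [ours] -/
theorem integral_sqrt_variance_sq_le_mean_drop (hρ : Continuous ρ) {a b : ℝ} (hab : a ≤ b) :
    (∫ t in a..b, Real.sqrt (variance (wilsonAction (d := d) (L := L) ρ)
        (wilsonMeasure (d := d) (L := L) ρ t))) ^ 2 ≤
      (b - a) * ((∫ U, wilsonAction ρ U ∂(wilsonMeasure (d := d) (L := L) ρ a)) -
        ∫ U, wilsonAction ρ U ∂(wilsonMeasure (d := d) (L := L) ρ b)) := by
  set V : ℝ → ℝ := fun t => variance (wilsonAction (d := d) (L := L) ρ)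
    (wilsonMeasure (d := d) (L := L) ρ t) with hV
  have hVc : Continuous V := continuous_variance_wilsonMeasure hρ
  have hV0 : ∀ t, 0 ≤ V t := fun t => variance_nonneg _ _
  have hsqc : Continuous fun t => Real.sqrt (V t) := Real.continuous_sqrt.comp hVc
  set I := ∫ t in a..b, Real.sqrt (V t) with hI
  set J := ∫ t in a..b, V t with hJ
  have hJ' : J = (∫ U, wilsonAction ρ U ∂(wilsonMeasure (d := d) (L := L) ρ a)) -
      ∫ U, wilsonAction ρ U ∂(wilsonMeasure (d := d) (L := L) ρ b) := by
    rw [hJ, hV, mean_sub_mean_eq_integral_variance (d := d) (L := L) ρ hρ a b]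
  rw [← hJ']
  -- for every real `λ`: `2λ·I ≤ λ²·(b−a) + J`
  have hquad : ∀ x : ℝ, 0 ≤ (b - a) * (x * x) + (-(2 * I)) * x + J := by
    intro x
    have hpt : ∀ t, 2 * x * Real.sqrt (V t) ≤ x ^ 2 + V t := by
      intro t
      have hs := Real.sq_sqrt (hV0 t)
      nlinarith [sq_nonneg (Real.sqrt (V t) - x)]
    have hint : ∫ t in a..b, 2 * x * Real.sqrt (V t) ≤ ∫ t in a..b, (x ^ 2 + V t) :=
      intervalIntegral.integral_mono_on hab ((continuous_const.mul hsqc).intervalIntegrable _ _)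
        ((continuous_const.add hVc).intervalIntegrable _ _) fun t _ => hpt t
    have h1 : ∫ t in a..b, 2 * x * Real.sqrt (V t) = 2 * x * I := by
      rw [hI, intervalIntegral.integral_const_mul]
    have h2 : ∫ t in a..b, (x ^ 2 + V t) = (b - a) * x ^ 2 + J := by
      rw [intervalIntegral.integral_add (continuous_const.intervalIntegrable _ _)
        (hVc.intervalIntegrable _ _), intervalIntegral.integral_const, smul_eq_mul, hJ]
    rw [h1, h2] at hint
    nlinarith
  have hdisc := discrim_le_zero hquad
  rw [discrim] at hdisc
  nlinarith

/-- **`(∫_a^b √Var_t(S_W) dt)² ≤ (b − a)·2N·#plaq`** (`a ≤ b`): the thermodynamic length of the coupling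
window `[a, b]` is at most `√((b−a)·2N·#plaq)`, every compact gauge group, every volume — so the
length²/`k` necessity bound for `k`-step annealing never exceeds the uniform schedule's sufficiency bound
`2N·#plaq·(b−a)/k`. [ours] -/
theorem integral_sqrt_variance_sq_le (hρ : Continuous ρ) {a b : ℝ} (hab : a ≤ b) :
    (∫ t in a..b, Real.sqrt (variance (wilsonAction (d := d) (L := L) ρ)
        (wilsonMeasure (d := d) (L := L) ρ t))) ^ 2 ≤
      (b - a) * (2 * N * Fintype.card (Plaquette d L)) := by
  refine (integral_sqrt_variance_sq_le_mean_drop (d := d) (L := L) ρ hρ hab).trans ?_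
  have hA := mean_wilsonAction_le (d := d) (L := L) ρ hρ a
  have hB := mean_wilsonAction_nonneg (d := d) (L := L) ρ hρ b
  exact mul_le_mul_of_nonneg_left (by linarith) (sub_nonneg.2 hab)

/-! ## §3 What a volume-uniform specific-heat FLOOR can look like -/

/-- **NO `c/u` FLOOR**: for `β₀ > 0` and `c > 0` it is impossible that `c/u ≤ Var_u(S_W^ρ)` for all
`u ≥ β₀` — in any one volume (`∫_{β₀}^{T} c/u du = c·log(T/β₀)` is unbounded, the integrated specific
heat is not). [ours] -/
theorem not_variance_ge_div (hρ : Continuous ρ) {β₀ c : ℝ} (hβ₀ : 0 < β₀) (hc : 0 < c) :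
    ¬ ∀ u : ℝ, β₀ ≤ u → c / u ≤ variance (wilsonAction (d := d) (L := L) ρ)
      (wilsonMeasure (d := d) (L := L) ρ u) := by
  intro hfloor
  set V : ℝ → ℝ := fun t => variance (wilsonAction (d := d) (L := L) ρ)
    (wilsonMeasure (d := d) (L := L) ρ t) with hV
  set P : ℝ := 2 * N * Fintype.card (Plaquette d L) with hP
  have hP0 : 0 ≤ P := by rw [hP]; positivity
  -- the window `[β₀, T]` with `c·log(T/β₀) = P + 1`
  set T : ℝ := β₀ * Real.exp ((P + 1) / c) with hT
  have hT1 : β₀ ≤ T := by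
    rw [hT]
    have : 1 ≤ Real.exp ((P + 1) / c) := Real.one_le_exp (by positivity)
    nlinarith
  have hlog : Real.log (T / β₀) = (P + 1) / c := by
    rw [hT, mul_div_cancel_left₀ _ hβ₀.ne', Real.log_exp]
  have h0 : (0 : ℝ) ∉ Set.uIcc β₀ T := by
    rw [Set.uIcc_of_le hT1]; intro h; exact absurd h.1 (not_le.2 hβ₀)
  have hinv : ∫ u in β₀..T, c / u = P + 1 := by
    simp_rw [div_eq_mul_inv]
    rw [intervalIntegral.integral_const_mul, integral_inv h0, hlog]
    field_simp
  have hci : IntervalIntegrable (fun u : ℝ => c / u) volume β₀ T := by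
    refine (continuousOn_const.div continuousOn_id fun u hu => ?_).intervalIntegrable
    rw [Set.uIcc_of_le hT1] at hu
    exact (hβ₀.trans_le hu.1).ne'
  have hmono : ∫ u in β₀..T, c / u ≤ ∫ u in β₀..T, V u :=
    intervalIntegral.integral_mono_on hT1 hci
      ((continuous_variance_wilsonMeasure hρ).intervalIntegrable _ _) fun u hu => hfloor u hu.1
  have hceil := integral_variance_le (d := d) (L := L) ρ hρ β₀ T
  rw [hinv] at hmono
  rw [← hP] at hceil
  linarith

/-- **A `c/u²` FLOOR FORCES `c ≤ 2N·#plaq·β₀`**: if `c/u² ≤ Var_u(S_W^ρ)` for all `u ≥ β₀ > 0` (one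
volume suffices) then `c ≤ 2N·#plaq·β₀` (`∫_{β₀}^T c/u² du = c(1/β₀ − 1/T) ≤ 2N·#plaq` for every `T`).
[ours] -/
theorem floor_const_le_of_sq (hρ : Continuous ρ) {β₀ c : ℝ} (hβ₀ : 0 < β₀)
    (hfloor : ∀ u : ℝ, β₀ ≤ u → c / u ^ 2 ≤ variance (wilsonAction (d := d) (L := L) ρ)
      (wilsonMeasure (d := d) (L := L) ρ u)) :
    c ≤ 2 * N * Fintype.card (Plaquette d L) * β₀ := by
  set V : ℝ → ℝ := fun t => variance (wilsonAction (d := d) (L := L) ρ)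
    (wilsonMeasure (d := d) (L := L) ρ t) with hV
  set P : ℝ := 2 * N * Fintype.card (Plaquette d L) with hP
  have hP0 : 0 ≤ P := by rw [hP]; positivity
  -- for every `T ≥ β₀`: `c·(1/β₀ − 1/T) ≤ P`
  have hwin : ∀ T : ℝ, β₀ ≤ T → c * (1 / β₀ - 1 / T) ≤ P := by
    intro T hT1
    have hT0 : 0 < T := hβ₀.trans_le hT1
    have h0 : (0 : ℝ) ∉ Set.uIcc β₀ T := by
      rw [Set.uIcc_of_le hT1]; intro h; exact absurd h.1 (not_le.2 hβ₀)
    have hzpow : ∫ u in β₀..T, u ^ (-2 : ℤ) = (T ^ (-1 : ℤ) - β₀ ^ (-1 : ℤ)) / (-1 : ℝ) := by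
      have h := integral_zpow (a := β₀) (b := T) (n := -2) (Or.inr ⟨by norm_num, h0⟩)
      rw [h]; norm_num
    have hsq : ∫ u in β₀..T, c / u ^ 2 = c * (1 / β₀ - 1 / T) := by
      have hre : (fun u : ℝ => c / u ^ 2) = fun u : ℝ => c * u ^ (-2 : ℤ) := by
        funext u; rw [zpow_neg, zpow_ofNat, div_eq_mul_inv]
      rw [hre, intervalIntegral.integral_const_mul, hzpow, zpow_neg_one, zpow_neg_one]
      field_simp
      ring
    have hci : IntervalIntegrable (fun u : ℝ => c / u ^ 2) volume β₀ T := by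
      refine (continuousOn_const.div (continuousOn_id.pow 2) fun u hu => ?_).intervalIntegrable
      rw [Set.uIcc_of_le hT1] at hu
      exact pow_ne_zero 2 (hβ₀.trans_le hu.1).ne'
    have hmono : ∫ u in β₀..T, c / u ^ 2 ≤ ∫ u in β₀..T, V u :=
      intervalIntegral.integral_mono_on hT1 hci
        ((continuous_variance_wilsonMeasure hρ).intervalIntegrable _ _) fun u hu => hfloor u hu.1
    have hceil := integral_variance_le (d := d) (L := L) ρ hρ β₀ T
    rw [hsq] at hmono
    rw [← hP] at hceil
    linarith
  -- `c ≥ 0` (from the floor at `u = β₀` and `Var ≤ ∫`-type positivity is not needed: use `T → ∞`)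
  -- let `T → ∞` through `T = β₀·m`, `m ≥ 1`: `c/β₀ − c/(β₀ m) ≤ P`
  by_contra hlt
  rw [not_le] at hlt
  -- then `c > 0`
  have hc0 : 0 < c := lt_of_le_of_lt (by positivity) hlt
  -- choose `T` with `c/T < c/β₀ − P`
  have hgap : 0 < c / β₀ - P := by
    rw [sub_pos, lt_div_iff₀ hβ₀]; linarith
  set T : ℝ := max β₀ (2 * c / (c / β₀ - P)) with hT
  have hT1 : β₀ ≤ T := le_max_left _ _
  have hT0 : 0 < T := hβ₀.trans_le hT1
  have hT2 : 2 * c / (c / β₀ - P) ≤ T := le_max_right _ _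
  have hcT : c / T ≤ (c / β₀ - P) / 2 := by
    rw [div_le_iff₀ hT0]
    have : 2 * c ≤ T * (c / β₀ - P) := by
      have h := (div_le_iff₀ hgap).1 hT2
      linarith
    linarith
  have h := hwin T hT1
  have h' : c * (1 / β₀ - 1 / T) = c / β₀ - c / T := by ring
  rw [h'] at h
  linarith

end AnyGroup

/-! ## §4 Docking with item 125's typed hypothesis (SH_W): its constant is at most `2n·β₀` -/

section SUN

open Summit.Ventures.LatticeQCDFlow.Theory2.SpecificHeat

variable {d L n : ℕ} [NeZero L]

/-- **THE CONSTANT OF (SH_W) IS AT MOST `2n·β₀`**: if `WilsonSpecificHeatFloor d L n β₀ c` (item 125: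
`∀ u ≥ β₀, c·#plaq/u² ≤ Var_u(S_W)`, `SU(n)`, one volume `L`, `d ≥ 2` so that `#plaq ≥ 1`) and `β₀ > 0`,
then `c ≤ 2n·β₀`.  In particular the constant `c(d, n, β₀)` of theory2's theorem (SH_W) (item 128,
`wilsonSpecificHeatFloorUniform`) is `O(β₀)` as `β₀ → 0`. [ours] -/
theorem wilsonSpecificHeatFloor_const_le (hd : 2 ≤ d) {β₀ c : ℝ} (hβ₀ : 0 < β₀)
    (hSH : WilsonSpecificHeatFloor d L n β₀ c) : c ≤ 2 * n * β₀ := by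
  have hP : 0 < (Fintype.card (Plaquette d L) : ℝ) := by
    exact_mod_cast WilsonPinching.one_le_card_plaquette (L := L) hd
  have hfloor : ∀ u : ℝ, β₀ ≤ u → c * Fintype.card (Plaquette d L) / u ^ 2 ≤
      variance (wilsonAction (d := d) (L := L) (StrongCoupling.defRep n))
        (wilsonMeasure (d := d) (L := L) (StrongCoupling.defRep n) u) := by
    intro u hu
    have h := hSH u hu
    unfold actionVar at h
    rwa [Theory2.WilsonSpecificHeat.variance_amb_eq u] at h
  have h := floor_const_le_of_sq (d := d) (L := L) (StrongCoupling.defRep n) continuous_subtype_val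
    hβ₀ hfloor
  -- `c·#plaq ≤ 2n·#plaq·β₀`
  have h' : c * Fintype.card (Plaquette d L) ≤ (2 * n * β₀) * Fintype.card (Plaquette d L) := by
    linarith
  exact le_of_mul_le_mul_right h' hP

end SUN

end Summit.Ventures.LatticeQCDFlow.TrivializingMaps

end
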